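import Summits.BirchSwinnertonDyer.Rank1Residual.O5.HeegnerLogTransportThreeGlobal
import Summits.BirchSwinnertonDyer.Rank1Residual.O5.HeegnerLogTransportThreeTargets
import Summits.BirchSwinnertonDyer.Rank1Residual.O5.HeegnerIndexThree
import Summits.BirchSwinnertonDyer.Rank1Residual.Partition.Bsdp
import Literature.NumberTheory.EllipticCurves.LFunctionPrimeCoeff
import Literature.NumberTheory.EllipticCurves.LeadingTermTamagawaProofs
import Literature.NumberTheory.EllipticCurves.BSDQuadraticDescentShaOddPartGeneralProofs
import HarnessLib
import HarnessLib.Audit.Tags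

/-!
# Heegner-log transport at `p = 3` (KL3), part 4: the COMPANION side at a good ORDINARY `3` is covered in print — o5-r2 GEN 17

HONEST FRAMING (cell `b2b-bsdres`, run/shared/lean/b2b/bsd-rank1-residual/, verbatim in every file): the
goal of the cell is to DELETE the COMBINATION-SHAPED residual classes of the Birch–Swinnerton-Dyer formula
for ALL analytic-rank `≤ 1` elliptic curves over `ℚ` — "full BSD formula for every rank `≤ 1` curve in
class `C`" assembled STRICTLY from published theorems — so that the rank-`≤ 1` remainder becomes exactly
the CONSTRUCTION-SHAPED classes, which are TYPED (missing-input `Prop`s), NOT attempted. This is not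
"finishing BSD". Team O5 (tame potentially supersingular additive `p = 3`, (t′)), planner o5-r2 (the
non-Iwasawa side), GEN 17; RESEARCH ROUTE; THEOREMS ONLY (bookkeeping over explicit hypotheses); no named
fact, no definition of a new object, no conjecture node is introduced; NOTHING is booked and no mark of
`RESIDUAL-MAP.md` moves.

## What this file records (erratum E-KL3-2 to o5-r2 GEN 16, and its kernel form)

GEN 16 typed the companion-side input of the KL3 chain, KL3-D `GoodHeegnerLogUnitThree`
(`O5/HeegnerLogTransportThreeTargets.lean` §4), as "OPEN at `p = 3` = Wan's divisibility at 3"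
(Burungale–Castella–Skinner, IMRN 2025, p. 5). For a companion `G` that is good ORDINARY at `3` with
`ρ_{G,3^∞}` onto this label is SUPERSEDED by the cell's own register: the `3`-part of BSD for such `G`
(both analytic ranks `≤ 1`) is row C16 of the partition — Yan–Zhu, J. Algebra 693 (2026) Thm. 4.15
(tree NAMED FACT `YanZhu2026.thm415_padicValRat_bsd_rank_le_one`, PUB*, cell flag `YZ26@3-BF-ERL-Ohta`;
RESIDUAL-MAP §A "good ordinary, surj(3), both ranks: COVERED [PUB*] T6"), consumed in the kernel by
`Partition.RowC16.bsdp`. This file PROVES, over explicit hypotheses and with every published input an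
explicit binder:

* §1 `nsCount_eq_reductionPointCount_of_good`, `companion_logUnit_of_index_unit` — the companion-side
  "L1♭": at a GOOD prime `3`, if `3 ∤ [G(K) : ℤP′]` (finite index) and SOME `Q ∈ G(K)` of infinite order
  is `3`-primitive at `ι₃` (`ord₃ log_{ω_G} Q + ord₃ #G̃(𝔽₃) − 1 = 0`), then the Heegner point `P′` is
  `3`-primitive too (`hGunit` of the W-side chain `padicValNat_index_eq_zero_of_companion_unit'`). Pure
  valuation bookkeeping on X11b's local-index line `Ψ : G(ℚ₃)/G⁽²⁾ → ℤ₃` (Castella 2018 (calcul)); the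
  "integrality" `ord₃ log_{ω_G} X + ord₃ #G̃(𝔽₃) − 1 ≥ 0` is automatic there (a `ℤ₃`-valuation).
* §2 `padicValNat_index_eq_zero_of_missingPPartAt_pair` — the `Ш(G/K)[p^∞] = 0` slice of Gross's
  identity READ BACKWARDS from the `p`-part of BSD for BOTH members of the Heegner pair `(G, G^{(d_K)})`
  in Miller's currency (`MissingPPartAt`) and the per-pair STEP-0 identity of the analytic orders
  (Gross–Zagier in the census currency, the cell's standing explicit binder): `p ∤ [G(K) : ℤP′]`. Any odd
  `p`, any reduction; linear bookkeeping + the odd-part splitting of `Ш` over a quadratic field (tree).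
* §3 `goodOrd_companion_logUnit_three` — KL3-D's conclusion for a good ORDINARY companion, from
  Yan–Zhu Thm. 4.15 (`hYZ`) applied to `G` AND to a model `Gd` of `G^{(d_K)}` (row C16 for both: good
  ordinary at 3, `ρ̄` irreducible, surj(3) ∨ ram), Wuthrich 2014 Lemma 20 (`hW20`), modularity (`hmod`),
  Gross–Zagier–Kolyvagin (`hGZK`), STEP-0, and the per-pair data (`Ш`-freeness is NOT assumed: it is READ
  from the two analytic orders being `3`-units, which is what the census computes).
* §4 `o5_index_unit_of_goodOrd_companion` — composed with GEN 16's W-side chain: KL3-A (Kriz–Li 2019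
  Thm. 1.16 at `p = 3`, `m = 1`, a theorem in print, hypothesis `hA`) + §3 ⇒ `3 ∤ [W(K) : ℤP_W]` for the
  (t′) curve `W`. NET EFFECT ON THE KL3 CHAIN: for ORDINARY companions the chain KL3-A → KL3-C♭ no longer
  imports any OPEN conjecture on the companion side — its remaining non-print inputs are the W-side count
  KL3-B and the matching KL3-M (theorem-candidates), exactly as typed in part 1. For SUPERSINGULAR
  companions (`a₃(G) ≡ 0`) KL3-D stays OPEN (signed BDP main conjecture at 3), as GEN 16 said.

What this does NOT do: it does not prove KL3-D as typed (whose hypothesis is `Ш(G/K)[3^∞] = 0` rather than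
the two analytic `3`-units; the two are equivalent GIVEN row C16, and §3b records that direction too:
`goodOrd_companion_logUnit_three_of_sha`), it books nothing, and every use inherits the flag
`YZ26@3-BF-ERL-Ohta` of the named fact. O5 OPEN.

References: X. Yan, X. Zhu, J. Algebra 693 (2026) Thm. 4.15 [YanZhu2024MainConjNonCM]; D. Kriz, C. Li,
Forum Math. Sigma 7 (2019) e15, Thm. 1.16, Rem. 1.17 [KrizLi2019]; B. H. Gross, LMS LN 153 (1991) Conj. 1.2,
Prop. 2.1 [GrossLMS1991]; F. Castella, Math. Ann. 370 (2018) Thm. 2.3 (calcul) [Castella2018];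
C. Wuthrich, LMS LN 414 (2014) Lemma 20 [Wuthrich2014]; R. L. Miller, LMS JCM 14 (2011) Def. 1.1
[Miller2011LMS]; A. Burungale, F. Castella, C. Skinner, IMRN 2025 p. 5 [BurungaleCastellaSkinner2025];
HOME/b2b-bsdres-o5-r2/gen17/O5-GEN17.md (E-KL3-2).

## TYPER PLACEMENT NOTE (cc-typer-5 GEN 18 = O5 §3.5 / O6 §3.4 typer of record; by-name ask A-O5-G17-1 of o5-r2 GEN 17, HOME/INBOX.md
l.13534: 'please land … verbatim under `O5/` (suggested `HeegnerLogTransportThreeOrdCompanion.lean`, your naming; it only imports tree files)')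

Source: `HOME/b2b-bsdres-o5-r2/gen17/lean/GoodOrdCompanionThree.lean` sha16 `15549451a2e009ba` (426 l.; o5-r2 GEN 17's file of record, `gen17/SHA16.txt`; HOME/INBOX.md l.13534; `cells/o5o6/TARGETS.md` `#### o5-r2 GEN 17` l.2455), re-hashed by the typer
right before writing (o5-r2's `lean check` rc 0 / 0 sorries / 0 warnings 22:3xZ; the typer's farm check of the source rc 0 / 0 warnings, axioms of the END theorem
`o5_index_unit_of_goodOrd_companion` = {propext, Classical.choice, Quot.sound}; DEDUP `lean search --decl` on all eight theorem names: no match).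
PLACEMENT = the source VERBATIM, split in TWO files for `lint.size` (≤ 400 l.; the source is 426 l.): THIS file = the imports + module text + §1–§2
(`nsCount_eq_reductionPointCount_of_good`, `not_isOfFinAddOrder_nsmul`, `companion_logUnit_of_index_unit`; `padicValNat_index_eq_zero_of_missingPPartAt_pair`,
`padicValRat_shaAn_pair_eq_zero_of_sha_trivial`); the sibling `O5/HeegnerLogTransportThreeOrdCompanionIndex.lean` = §3–§4 (`goodOrd_companion_logUnit_three`,
`goodOrd_companion_logUnit_three_of_sha`, END `o5_index_unit_of_goodOrd_companion`).  Every declaration block is byte-identical to the source and in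
source order (script-verified, `class-closure/typer-5/gen18/g17_place.py`); THEOREMS ONLY: 0 `def`, 0 `@[conjecture]` node, 0 Literature facts (net
named-fact debt 0), no `sorry`; every published input stays an explicit binder (`hYZ` = the tree's NAMED FACT `YanZhu2026.thm415_padicValRat_bsd_rank_le_one`,
PUB*, flag `YZ26@3-BF-ERL-Ohta`; `hW20`, `hmod`, `hGZK`, `hA` = KL3-A).  Part 4 of the KL3 files: parts 1–3 = `O5/HeegnerLogTransportThree{,Chain,Targets}.lean`
(p340741 / p341262 / p341640), the global reading `O5/HeegnerLogTransportThreeGlobal.lean` (p342632).  The E-KL3-2 docstring rider on KL3-D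
`GoodHeegnerLogUnitThree` (`…Targets.lean` §4) asked in the same line is a separate DOC-ONLY touch at that file's next docketed touch.  HONEST FRAMING
(cell `b2b-bsdres`): research route, lane CLASS-CLOSURE §3.5 O5; nothing asserted beyond the displayed binders, nothing booked, no mark of `RESIDUAL-MAP.md`
moves; census C-KL3-V = EVIDENCE, never a Literature fact; O5 OPEN.
-/

noncomputable section

open scoped Classical

open WeierstrassCurve Literature.NumberTheory.EllipticCurves
  Literature.NumberTheory.EllipticCurves.ModularForms
  Literature.NumberTheory.EllipticCurves.Rank1Residual
  Literature.NumberTheory.EllipticCurves.Rank1Residual.Typed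

namespace Summit.BirchSwinnertonDyer.Rank1Residual.O5.HeegnerLogTransport

open Summit.BirchSwinnertonDyer.Rank1Residual.X11b (padicLogOrd embAt padicPointOf)
open Summit.BirchSwinnertonDyer.Rank1Residual.X11b.LocalIndex (psi
  exists_addEquiv_valuation_psi_padicPointOf valuation_psi_zsmul_add)
open Literature.NumberTheory.EllipticCurves.Rank1Residual (Addv)
open IsDedekindDomain (HeightOneSpectrum)
open scoped NumberField

/-! ## §1 The companion-side L1♭ at a GOOD prime 3: index unit + one primitive point ⇒ primitive Heegner point -/

/-- At a prime `ℓ` of GOOD reduction Kriz–Li's non-singular count `nsCount G ℓ = ℓ + 1 − a_ℓ(G)` is the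
tree's `reductionPointCount G ℓ = #G̃(𝔽_ℓ)` (`a_ℓ =` the `L`-series coefficient `=` the trace of
Frobenius at good `ℓ`, tree `LFunction_apply_prime_eq_frobeniusTrace`). [cite: SilvermanAEC2009, Exercise 8.19(a) (p. 230)] -/
theorem nsCount_eq_reductionPointCount_of_good (G : WeierstrassCurve ℚ) [G.IsElliptic] [G.IsGloballyMinimal]
    (ℓ : ℕ) [hℓ : Fact ℓ.Prime] (hgood : G.HasGoodReductionAtPrime ℓ) :
    nsCount G ℓ = (reductionPointCount G ℓ : ℤ) := by
  have hL := LFunction_apply_prime_eq_frobeniusTrace G ℓ hgood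
  unfold nsCount
  rw [dif_pos hℓ.out, if_pos hgood, hL]
  unfold WeierstrassCurve.frobeniusTrace
  ring

/-- `I • Q` has infinite order when `Q` has and `I ≠ 0`. [folklore] -/
theorem not_isOfFinAddOrder_nsmul {A : Type*} [AddCommGroup A] {Q : A} (hQ : ¬ IsOfFinAddOrder Q)
    {I : ℕ} (hI : I ≠ 0) : ¬ IsOfFinAddOrder (I • Q) := by
  intro h
  apply hQ
  obtain ⟨m, hm, hmQ⟩ := (isOfFinAddOrder_iff_nsmul_eq_zero).mp h
  refine (isOfFinAddOrder_iff_nsmul_eq_zero).mpr ⟨m * I, Nat.mul_pos hm (Nat.pos_of_ne_zero hI), ?_⟩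
  rw [mul_nsmul', hmQ]

/-- **Companion-side L1♭ (GOOD prime 3; pure bookkeeping on the local index line).** For `G/ℚ` globally
minimal with good reduction at `3`, an embedding `ι₃ : K →+* ℚ₃`, and `P′, Q ∈ G(K)` of infinite order:
if `ℤP′` has finite index prime to `3` in `G(K)` and `Q` is `3`-PRIMITIVE at `ι₃` in Kriz–Li's
normalisation (`ord₃ log_{ω_G} Q + ord₃ #G̃(𝔽₃) − 1 = 0`, i.e. `Ψ(Q_ι)` is a unit of `ℤ₃`), then so is
`P′`: `ord₃ log_{ω_G} P′ + ord₃ #G̃(𝔽₃) − 1 = 0`. Proof: `I • Q = n • P′` in `G(K)` (`I` the index), read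
on X11b's line `Ψ` (`v(Ψ(m • x)) = ord₃ m + v(Ψ x)`, Castella 2018 (calcul); `c₃ = 1` at good reduction):
`0 = ord₃ I + v(Ψ Q_ι) = ord₃ n + v(Ψ P′_ι) ≥ v(Ψ P′_ι) ≥ 0`. This is the `hGunit` input of the W-side
chain (`padicValNat_index_eq_zero_of_companion_unit'`). [cite: Castella2018, proof of Thm. 2.3, (calcul) (arXiv:1704.06608 p. 6)]
[cite: KrizLi2019, Rem. 1.17 (the factor `|Ẽ^{ns}(𝔽_ℓ)|/ℓ`)] -/
theorem companion_logUnit_of_index_unit (G : WeierstrassCurve ℚ) [G.IsElliptic] [G.IsGloballyMinimal]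
    (hgood : G.HasGoodReductionAtPrime 3) {K : Type} [Field K] [NumberField K] (ι₃ : K →+* ℚ_[3])
    (P' Q : (G.baseChange K).toAffine.Point) (hP' : ¬ IsOfFinAddOrder P') (hQ : ¬ IsOfFinAddOrder Q)
    (hI0 : (AddSubgroup.zmultiples P').index ≠ 0)
    (hI : padicValNat 3 (AddSubgroup.zmultiples P').index = 0)
    (hQunit : padicLogOrd G 3 ι₃ Q + padicValInt 3 (nsCount G 3) - 1 = 0) :
    padicLogOrd G 3 ι₃ P' + padicValInt 3 (nsCount G 3) - 1 = 0 := by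
  haveI : ((G.baseChange ℚ_[3]).formalFiltration 2).FiniteIndex :=
    (G.baseChange ℚ_[3]).finiteIndex_formalFiltration 2
  obtain ⟨φ, hφ⟩ := exists_addEquiv_valuation_psi_padicPointOf G 3 (K := K)
  -- identifications at the good prime 3
  have hc : (G.baseChange ℚ_[3]).localTamagawaNumber ℤ_[3] = 1 :=
    localTamagawaNumber_padic_eq_one_of_good_holds G 3 hgood
  have hns : ((padicValNat 3 (reductionPointCount G 3) : ℕ) : ℤ) = padicValInt 3 (nsCount G 3) := by
    rw [nsCount_eq_reductionPointCount_of_good G 3 hgood, padicValInt.of_nat]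
  -- the two points read in G(ℚ₃)
  have hP'ι : ¬ IsOfFinAddOrder (padicPointOf G 3 ι₃ P') := not_isOfFinAddOrder_padicPointOf G 3 ι₃ P' hP'
  have hQι : ¬ IsOfFinAddOrder (padicPointOf G 3 ι₃ Q) := not_isOfFinAddOrder_padicPointOf G 3 ι₃ Q hQ
  have eP := hφ ι₃ P' hP'ι
  have eQ := hφ ι₃ Q hQι
  rw [hc] at eP eQ
  have hvQ : ((psi ((G.baseChange ℚ_[3]).formalFiltration 2) φ (padicPointOf G 3 ι₃ Q)).valuation : ℤ) = 0 := by
    rw [eQ]; simp only [padicValNat_one_right, CharP.cast_eq_zero, add_zero]; rw [hns]; exact hQunit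
  -- the index relation `I • Q = n • P′`
  set I := (AddSubgroup.zmultiples P').index with hIdef
  have hmem : I • Q ∈ AddSubgroup.zmultiples P' := AddSubgroup.nsmul_index_mem _ Q
  obtain ⟨n, hn⟩ := AddSubgroup.mem_zmultiples_iff.mp hmem
  have hIQ : ¬ IsOfFinAddOrder (I • Q) := not_isOfFinAddOrder_nsmul hQ hI0
  have hn0 : n ≠ 0 := by
    rintro rfl
    rw [zero_zsmul] at hn
    exact hIQ (hn ▸ (isOfFinAddOrder_iff_nsmul_eq_zero).mpr ⟨1, one_pos, by simp⟩)
  have hI0' : ((I : ℕ) : ℤ) ≠ 0 := by exact_mod_cast hI0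
  have ht : IsOfFinAddOrder (0 : (G.baseChange ℚ_[3]).toAffine.Point) :=
    (isOfFinAddOrder_iff_nsmul_eq_zero).mpr ⟨1, one_pos, by simp⟩
  have h1 := valuation_psi_zsmul_add ((G.baseChange ℚ_[3]).formalFiltration 2) φ hP'ι ht hn0
  have h2 := valuation_psi_zsmul_add ((G.baseChange ℚ_[3]).formalFiltration 2) φ hQι ht hI0'
  -- `n • P′_ι = I • Q_ι` in `G(ℚ₃)`
  have hmap : n • padicPointOf G 3 ι₃ P' + 0 = ((I : ℕ) : ℤ) • padicPointOf G 3 ι₃ Q + 0 := by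
    rw [add_zero, add_zero, natCast_zsmul]
    unfold padicPointOf
    rw [← map_zsmul, ← map_nsmul, hn]
  rw [hmap] at h1
  have h3 : padicValNat 3 (((I : ℕ) : ℤ).natAbs) = 0 := by rw [Int.natAbs_natCast]; exact hI
  rw [h3, zero_add] at h2
  -- compare the two evaluations of `v(Ψ(I • Q_ι))`
  have hvQ' : (psi ((G.baseChange ℚ_[3]).formalFiltration 2) φ (padicPointOf G 3 ι₃ Q)).valuation = 0 := by exact_mod_cast hvQ
  rw [hvQ'] at h2
  rw [h2] at h1
  have hvP : (psi ((G.baseChange ℚ_[3]).formalFiltration 2) φ (padicPointOf G 3 ι₃ P')).valuation = 0 := by omega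
  have hvP' : ((psi ((G.baseChange ℚ_[3]).formalFiltration 2) φ (padicPointOf G 3 ι₃ P')).valuation : ℤ) = 0 := by exact_mod_cast hvP
  rw [eP] at hvP'
  simp only [padicValNat_one_right, CharP.cast_eq_zero, add_zero] at hvP'
  rw [hns] at hvP'
  exact hvP'

/-! ## §2 The `Ш(G/K)[p^∞] = 0` slice of Gross's identity, read BACKWARDS from the `p`-part of BSD for the pair -/

/-- **Index unit from the `p`-part of BSD for both members of a Heegner pair.** For an odd prime `p`, a
quadratic `K`, `G/ℚ` and a `ℚ`-model `Gd` of `G^{(d_K)}`, both with FINITE `Ш` (Gross–Zagier–Kolyvagin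
at a Heegner pair), suppose the `p`-part of BSD holds for BOTH in Miller's currency
(`MissingPPartAt G p`, `MissingPPartAt Gd p`: `ord_p #Ш_an = ord_p #Ш`) and the per-pair STEP-0 identity
of the analytic orders holds (`hstep0`: Gross–Zagier in the census currency,
`ord_p #Ш_an(G) + ord_p #Ш_an(G^K) + 2 ord_p ∏c_q + 2 ord_p c_{D′} = 2 ord_p [G(K) : ℤP′]`). If the two
ANALYTIC orders are `p`-units, `p ∤ ∏_q c_q(G)` and `p ∤ c_{D′}`, then `p ∤ [G(K) : ℤP′]` — and
`Ш(G/K)[p^∞] = 0` as well (odd-part splitting `#Ш(G/K)[p^∞] = #Ш(G)[p^∞] · #Ш(G^K)[p^∞]`, tree). This is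
the `Ш = 0` slice of Gross's Conjecture 1.2 at the pair, obtained from BSD_p of the two members instead
of being assumed; linear bookkeeping. [cite: GrossLMS1991, §1 Conj. 1.2 (p. 237)]
[cite: Miller2011LMS, Def. 1.1 (arXiv:1010.2431 p. 3)] -/
theorem padicValNat_index_eq_zero_of_missingPPartAt_pair
    (G : WeierstrassCurve ℚ) [G.IsElliptic] [Finite G.sha] (Gd : WeierstrassCurve ℚ) [Gd.IsElliptic]
    [Finite Gd.sha] (K : Type) [Field K] [NumberField K] (hK : IsImaginaryQuadratic K)
    (hGd : ∃ C : VariableChange ℚ, C • G.quadraticTwist (NumberField.discr K : ℚ) = Gd)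
    (p : ℕ) [Fact p.Prime] (hp : p ≠ 2) (hMG : MissingPPartAt G p) (hMGd : MissingPPartAt Gd p)
    (P' : (G.baseChange K).toAffine.Point) {T M : ℕ}
    {q₀ q₁ : ℚ} (hq₀ : shaAn G = (q₀ : ℂ)) (hq₁ : shaAn Gd = (q₁ : ℂ))
    (hstep0 : padicValRat p q₀ + padicValRat p q₁ + ((2 * T : ℕ) : ℤ) + ((2 * M : ℕ) : ℤ) =
      ((2 * padicValNat p (AddSubgroup.zmultiples P').index : ℕ) : ℤ))
    (hu₀ : padicValRat p q₀ = 0) (hu₁ : padicValRat p q₁ = 0) (hT : T = 0) (hM : M = 0) :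
    padicValNat p (AddSubgroup.zmultiples P').index = 0 ∧
      Nat.card (AddCommGroup.primaryComponent (G.baseChange K).sha p) = 1 := by
  haveI : Finite (AddCommGroup.primaryComponent G.sha p) := Finite.of_injective _ Subtype.val_injective
  haveI : Finite (AddCommGroup.primaryComponent Gd.sha p) := Finite.of_injective _ Subtype.val_injective
  haveI : (G.baseChange K).IsElliptic := by rw [WeierstrassCurve.baseChange]; infer_instance
  -- the index
  have hI : padicValNat p (AddSubgroup.zmultiples P').index = 0 := by
    have h : (((2 * padicValNat p (AddSubgroup.zmultiples P').index : ℕ) : ℤ)) = 0 := by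
      rw [← hstep0, hu₀, hu₁, hT, hM]; norm_num
    have h' : 2 * padicValNat p (AddSubgroup.zmultiples P').index = 0 := by exact_mod_cast h
    omega
  refine ⟨hI, ?_⟩
  -- Ш: both rational p-parts are trivial, hence so is the one over K
  obtain ⟨q, hq, hv⟩ := hMG
  have hqq : q = q₀ := by exact_mod_cast hq.symm.trans hq₀
  subst hqq
  obtain ⟨q', hq', hv'⟩ := hMGd
  have hqq' : q' = q₁ := by exact_mod_cast hq'.symm.trans hq₁
  subst hqq'
  have h0 : padicValNat p (Nat.card (AddCommGroup.primaryComponent G.sha p)) = 0 := by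
    rw [padicValNat_card_addPrimaryComponent (A := G.sha) p]
    have : (padicValNat p G.shaOrder : ℤ) = 0 := by rw [← hv, hu₀]
    simpa [WeierstrassCurve.shaOrder] using this
  have h1 : padicValNat p (Nat.card (AddCommGroup.primaryComponent Gd.sha p)) = 0 := by
    rw [padicValNat_card_addPrimaryComponent (A := Gd.sha) p]
    have : (padicValNat p Gd.shaOrder : ℤ) = 0 := by rw [← hv', hu₁]
    simpa [WeierstrassCurve.shaOrder] using this
  have hprod := G.card_primaryComponent_sha_baseChange_quadratic_of_odd_of_finite K hK.1 Gd hGd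
    (G.baseChange K) ⟨1, one_smul _ _⟩ p hp
  -- a finite p-group of p-adic valuation 0 is trivial
  have hpow₀ := card_addPrimaryComponent_eq_pow (A := G.sha) p
  have hpow₁ := card_addPrimaryComponent_eq_pow (A := Gd.sha) p
  rw [hprod]
  have key : ∀ {n : ℕ}, (∃ k : ℕ, n = p ^ k) → padicValNat p n = 0 → n = 1 := by
    rintro n ⟨k, rfl⟩ h
    rw [padicValNat.prime_pow] at h
    rw [h, pow_zero]
  rw [key ⟨_, hpow₀⟩ h0, key ⟨_, hpow₁⟩ h1]

/-- From the `p`-part of BSD for both members and `Ш(G/K)[p^∞] = 0`, the two ANALYTIC orders are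
`p`-units (the direction KL3-D's hypothesis needs): odd-part splitting + Miller's currency. [cite: Miller2011LMS, Def. 1.1 (arXiv:1010.2431 p. 3)] -/
theorem padicValRat_shaAn_pair_eq_zero_of_sha_trivial
    (G : WeierstrassCurve ℚ) [G.IsElliptic] [Finite G.sha] (Gd : WeierstrassCurve ℚ) [Gd.IsElliptic]
    [Finite Gd.sha] (K : Type) [Field K] [NumberField K] (hK : IsImaginaryQuadratic K)
    (hGd : ∃ C : VariableChange ℚ, C • G.quadraticTwist (NumberField.discr K : ℚ) = Gd)
    (p : ℕ) [Fact p.Prime] (hp : p ≠ 2) (hMG : MissingPPartAt G p) (hMGd : MissingPPartAt Gd p)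
    {q₀ q₁ : ℚ} (hq₀ : shaAn G = (q₀ : ℂ)) (hq₁ : shaAn Gd = (q₁ : ℂ))
    (hsha : Nat.card (AddCommGroup.primaryComponent (G.baseChange K).sha p) = 1) :
    padicValRat p q₀ = 0 ∧ padicValRat p q₁ = 0 := by
  haveI : Finite (AddCommGroup.primaryComponent G.sha p) := Finite.of_injective _ Subtype.val_injective
  haveI : Finite (AddCommGroup.primaryComponent Gd.sha p) := Finite.of_injective _ Subtype.val_injective
  haveI : (G.baseChange K).IsElliptic := by rw [WeierstrassCurve.baseChange]; infer_instance
  have hprod := G.card_primaryComponent_sha_baseChange_quadratic_of_odd_of_finite K hK.1 Gd hGd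
    (G.baseChange K) ⟨1, one_smul _ _⟩ p hp
  rw [hsha] at hprod
  have h0 : Nat.card (AddCommGroup.primaryComponent G.sha p) = 1 := Nat.eq_one_of_mul_eq_one_right hprod.symm
  have h1 : Nat.card (AddCommGroup.primaryComponent Gd.sha p) = 1 := Nat.eq_one_of_mul_eq_one_left hprod.symm
  have hv0 : padicValNat p G.shaOrder = 0 := by
    have := padicValNat_card_addPrimaryComponent (A := G.sha) p
    rw [h0, padicValNat_one_right] at this
    simpa [WeierstrassCurve.shaOrder] using this.symm
  have hv1 : padicValNat p Gd.shaOrder = 0 := by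
    have := padicValNat_card_addPrimaryComponent (A := Gd.sha) p
    rw [h1, padicValNat_one_right] at this
    simpa [WeierstrassCurve.shaOrder] using this.symm
  obtain ⟨q, hq, hv⟩ := hMG
  have hqq : q = q₀ := by exact_mod_cast hq.symm.trans hq₀
  subst hqq
  obtain ⟨q', hq', hv'⟩ := hMGd
  have hqq' : q' = q₁ := by exact_mod_cast hq'.symm.trans hq₁
  subst hqq'
  refine ⟨?_, ?_⟩
  · rw [hv, hv0]; simp
  · rw [hv', hv1]; simp

end Summit.BirchSwinnertonDyer.Rank1Residual.O5.HeegnerLogTransport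

end
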